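import Literature.Probability.RandomPlanarGeometry.RestrictionHullsHolds
import HarnessLib

/-!
# [LSW] Theorem 6.1 transposed to Dobrushin domains: the discharge

This file discharges the named fact
`Literature.Probability.RandomPlanarGeometry.IsSLELaw.hullRestriction_eightThirds`
(`ConformalRestrictionProofs`):

* G. F. Lawler, O. Schramm, W. Werner, *Conformal restriction: the chordal case*, J. Amer. Math.
  Soc. **16** (2003) 917–955, arXiv:math/0209343 (**[LSW]**), Thm. 6.1 (Restriction), p. 23:
  "Let `γ` be the SLE_{8/3} path starting at the origin and `A ∈ 𝒬*`, then
  `P[γ[0,∞) ∩ A = ∅] = Φ_A'(0)^{5/8}`. The law of `γ(0, ∞)` is therefore `P_{5/8}`", read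
  through Prop. 3.3 (3) ⇒ (1) (p. 11: `P_α` is `𝒜₁`-covariant, i.e. conditionally on
  `{γ ∩ A = ∅}` the curve `Φ_A(γ)` has the law of `γ`) and transported to an arbitrary Dobrushin
  domain `(D; a, b)` and a hull subdomain `D'` by a chordal uniformizing map: if `μ`, `μ'` are the
  chordal SLE_{8/3} laws of `D` and of `D'`, then `μ'(T) · μ{Γ ⊆ cl D'} = μ(T ∩ {Γ ⊆ cl D'})` for
  every Borel set `T` of curve classes.

The tree proves this statement from [LSW] Thm. 6.1 in the half-plane and the existence of the
SLE_{8/3} trace: `IsSLELaw.hullRestriction_eightThirds_of_sle_restriction` (`SLERestrictionLocal`;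
the transposition argument of `HullRestrictionSLE` — Riemann mapping, Carathéodory, the Jordan
curve and arc theorems, uniqueness in law of chordal SLE `IsSLECurve.map_eq_holds`, the kernel
continuity of `A ↦ Φ_A'(0)` ([LSW] Lemma 3.5, `HasRestrictionDeriv.tendsto_of_kernel_holds`) and
the null event `{Γ touches ∂D' without entering}` (`HullRestrictionNull`), all theorems of the
tree). Both inputs are theorems of the tree by now:

1. `sle_restriction_eightThirds` — [LSW] Thm. 6.1 in `(ℍ; 0, ∞)`:
   `sle_restriction_eightThirds_holds` (`RestrictionHullsHolds`), assembled from the printed §6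
   proof: Prop. 5.2/5.3 (the bounded martingale `h_t'(W_t)^{5/8}`,
   `sle_exists_isRestrictionMartingale_of_trace_facts`, `SLERestrictionMartingaleExists`),
   Lemma 6.2 (`RestrictionExitTime`), Lemma 6.3 (`SLERestrictionHitReduction` /
   `SLERestrictionHitStolz`), Lemma 2.1 and Prop. 3.3, with the Rohde–Schramm trace theorems;
2. `HasSLETrace (8/3)` — Rohde–Schramm (2005), Thm. 5.1 at `κ = 8/3 ≠ 8`:
   `hasSLETrace_eightThirds` (`RestrictionHullsHolds`, from `hasSLETrace_of_ne_eight_holds`,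
   `RohdeSchrammCor35Proofs`).

Hence the closed discharge `IsSLELaw.hullRestriction_eightThirds_holds` below, and its applied
form `IsSLELaw.hullRestriction_eightThirds_apply` for consumers. No new definition, no new named
fact.

## References

* [LSW] G. F. Lawler, O. Schramm, W. Werner, *Conformal restriction: the chordal case*, J. Amer.
  Math. Soc. 16 (2003) 917–955, arXiv:math/0209343: Thm. 6.1 (p. 23) and its proof (§6:
  Prop. 5.2, Prop. 5.3, Lemmas 6.2, 6.3), Prop. 3.3 with Lemma 3.2 (pp. 10–11), Lemma 3.5.
  [LawlerSchrammWerner2003Restriction]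
* S. Rohde, O. Schramm, *Basic properties of SLE*, Ann. of Math. 161 (2005) 883–924: Thm. 5.1,
  Thm. 6.1, Thm. 7.1. [RohdeSchramm2005]
* G. F. Lawler, *Conformally Invariant Processes in the Plane*, AMS (2005), §6.3 (chordal SLE in
  simply connected domains). [Lawler2005]
-/

open MeasureTheory
open scoped NNReal

namespace Literature.Probability.RandomPlanarGeometry

/-- **[LSW] Theorem 6.1 (Restriction), transposed to Dobrushin domains**
(`Literature.Probability.RandomPlanarGeometry.IsSLELaw.hullRestriction_eightThirds` holds): if
`μ`, `μ'` are the chordal SLE_{8/3} laws of a Dobrushin domain `D` and of a hull subdomain `D'`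
of `D`, then `μ'(T) · μ{Γ ⊆ cl D'} = μ(T ∩ {Γ ⊆ cl D'})` for every measurable set `T` of curve
classes — conditionally on staying in `cl D'`, chordal SLE_{8/3} in `D` is chordal SLE_{8/3} in
`D'`. From the tree's transposition (`IsSLELaw.hullRestriction_eightThirds_of_sle_restriction`)
fed with Thm. 6.1 in the half-plane (`sle_restriction_eightThirds_holds`) and Rohde–Schramm's
Thm. 5.1 at `κ = 8/3` (`hasSLETrace_eightThirds`).
[cite: LawlerSchrammWerner2003Restriction, Thm. 6.1 (p. 23) with Prop. 3.3 (3) ⇒ (1) (p. 11)] -/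
theorem IsSLELaw.hullRestriction_eightThirds_holds : IsSLELaw.hullRestriction_eightThirds :=
  IsSLELaw.hullRestriction_eightThirds_of_sle_restriction sle_restriction_eightThirds_holds
    hasSLETrace_eightThirds

/-- **[LSW] Theorem 6.1 transposed, applied form**: for chordal SLE_{8/3} laws `μ` of `D` and
`μ'` of a hull subdomain `D'` and a measurable `T`,
`μ' T * μ {Γ ⊆ cl D'} = μ (T ∩ {Γ ⊆ cl D'})`.
[cite: LawlerSchrammWerner2003Restriction, Thm. 6.1 (p. 23) with Prop. 3.3 (3) ⇒ (1) (p. 11)] -/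
theorem IsSLELaw.hullRestriction_eightThirds_apply {D D' : DobrushinDomain}
    {μ μ' : Measure (CurveClass ℂ)} (hμ : IsSLELaw ((8 : ℝ≥0) / 3) D μ)
    (hμ' : IsSLELaw ((8 : ℝ≥0) / 3) D' μ') (hD' : D.IsHullSubdomain D') {T : Set (CurveClass ℂ)}
    (hT : MeasurableSet T) :
    μ' T * μ (CurveClass.rangeSubset (closure D'.carrier)) =
      μ (T ∩ CurveClass.rangeSubset (closure D'.carrier)) :=
  IsSLELaw.hullRestriction_eightThirds_holds D D' hμ hμ' hD' T hT

end Literature.Probability.RandomPlanarGeometry
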